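import Literature.NumberTheory.Sieve.MontgomeryVaughan1975Lemma43Blocks
import HarnessLib

/-!
# Montgomery–Vaughan (1975), Lemma 4.3: the weighted terms `(h + N/P)⁻¹ |∑#_{x−h<p≤x} χ(p) log p|`
against the zeros — PROVED (from the block estimates)

H. L. Montgomery, R. C. Vaughan, *The exceptional set in Goldbach's problem*, Acta Arith. 27
(1975) 353–370 [MontgomeryVaughanActa1975], §4 Lemma 4.3 (4.2); P. X. Gallagher, Invent. Math.
11 (1970), §5. For ONE character and ONE pair `x, h ≤ N` this file bounds the weighted term of
(4.2) by the sum over the zeros at the FIXED scale `u₀` (`2 ≤ u₀ ≤ N`) plus negligible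
quantities:

* `weighted_gallagherTerm_le` — `χ` primitive mod `q`, `2 ≤ q ≤ P`:
  `(h + N/P)⁻¹ ‖gallagherTerm χ x h‖ ≤ ∑_{ρ} m(ρ) u₀^{β−1} + (P/N)((log 4 + 2) u₀ + E)`,
  `E = 2√N log N + 2 log(N+1) + K(log N + (N/T) log²(PNT))`;
* `weighted_gallagherTerm_modOne_le` — the character mod `1` (the zeros of `ζ` in
  `weilZeroIndex T`);
* `weighted_gallagherTermExc_self_le` — the exceptional character `χ̃` with its correction
  `+∑ n^{β̃−1}`: the zero `ρ₀ = β̃` (simple, in the box) is REMOVED from the zero sum, at the cost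
  `+1`.

The mechanism ("surgery", `gallagherTerm_split`): with `y = x − h` (truncated), the interval
`(y, x]` is cut at `u = max(y, u₀)`; the part `(y, u]` is either empty or bounded trivially by
`(log 4 + 2) u₀`; on `(u, x]` the block estimate (`exists_block_bound_char` /
`exists_block_bound_zeta`, passed in unpacked form as a hypothesis `HK` / `HC`) and
`‖Z(x) − Z(u)‖ ≤ (x − u) ∑_ρ m(ρ) u^{β−1} ≤ h ∑_ρ m(ρ) u₀^{β−1}` apply; finally
`(h + N/P)⁻¹ ≤ min(h⁻¹, P/N)`. Intervals with `x < u₀` are bounded trivially. No dyadic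
decomposition is needed because the zero sum is taken at the fixed scale `u₀ ≤ u`. No named facts.
-/

noncomputable section

open Finset Real
open scoped ArithmeticFunction.vonMangoldt Chebyshev

namespace Literature.NumberTheory.Sieve.MontgomeryVaughan1975

open Literature.NumberTheory.LFunctions
open Literature.NumberTheory.Sieve (chebyshevPsiChar)

/-! ### Surgery on the interval `(x − h, x]` -/

/-- `∑#` only depends on `x − h` (truncated subtraction). [folklore] -/
theorem gallagherTerm_congr {q : ℕ} (χ : DirichletCharacter ℂ q) {x h₁ h₂ : ℕ}
    (h : x - h₁ = x - h₂) : gallagherTerm χ x h₁ = gallagherTerm χ x h₂ := by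
  rw [gallagherTerm, gallagherTerm, charPrimeSum, charPrimeSum, h]

open scoped Classical in
/-- `∑#` with correction only depends on `x − h`. [folklore] -/
theorem gallagherTermExc_congr {r : ℕ} (χe : DirichletCharacter ℂ r) (β : ℝ) {q : ℕ}
    (χ : DirichletCharacter ℂ q) {x h₁ h₂ : ℕ} (h : x - h₁ = x - h₂) :
    gallagherTermExc χe β χ x h₁ = gallagherTermExc χe β χ x h₂ := by
  rw [gallagherTermExc, gallagherTermExc, gallagherTerm_congr χ h, h]

/-- `charPrimeSum` over `(y, x]` splits at `u`. [folklore] -/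
theorem charPrimeSum_split {q : ℕ} (χ : DirichletCharacter ℂ q) {y u x : ℕ} (hyu : y ≤ u)
    (hux : u ≤ x) :
    charPrimeSum χ x (x - y) = charPrimeSum χ u (u - y) + charPrimeSum χ x (x - u) := by
  rw [charPrimeSum, charPrimeSum, charPrimeSum, Nat.sub_sub_self (hyu.trans hux),
    Nat.sub_sub_self hyu, Nat.sub_sub_self hux, ← Finset.Ioc_union_Ioc_eq_Ioc hyu hux,
    Finset.filter_union, Finset.sum_union]
  exact Finset.disjoint_filter_filter (Finset.Ioc_disjoint_Ioc_of_le le_rfl)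

/-- `∑#` over `(y, x]` splits at `u`: `gallagherTerm χ x (x − y) = gallagherTerm χ u (u − y) +
gallagherTerm χ x (x − u)` for `y ≤ u ≤ x`. [folklore] -/
theorem gallagherTerm_split {q : ℕ} (χ : DirichletCharacter ℂ q) {y u x : ℕ} (hyu : y ≤ u)
    (hux : u ≤ x) :
    gallagherTerm χ x (x - y) = gallagherTerm χ u (u - y) + gallagherTerm χ x (x - u) := by
  rw [gallagherTerm, gallagherTerm, gallagherTerm, charPrimeSum_split χ hyu hux,
    Nat.sub_sub_self (hyu.trans hux), Nat.sub_sub_self hyu, Nat.sub_sub_self hux]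
  split_ifs
  · rw [← Finset.Ioc_union_Ioc_eq_Ioc hyu hux,
      Finset.card_union_of_disjoint (Finset.Ioc_disjoint_Ioc_of_le le_rfl)]
    push_cast; ring
  · ring

open scoped Classical in
/-- `∑#` with correction splits likewise. [folklore] -/
theorem gallagherTermExc_split {r : ℕ} (χe : DirichletCharacter ℂ r) (β : ℝ) {q : ℕ}
    (χ : DirichletCharacter ℂ q) {y u x : ℕ} (hyu : y ≤ u) (hux : u ≤ x) :
    gallagherTermExc χe β χ x (x - y) =
      gallagherTermExc χe β χ u (u - y) + gallagherTermExc χe β χ x (x - u) := by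
  rw [gallagherTermExc, gallagherTermExc, gallagherTermExc, gallagherTerm_split χ hyu hux,
    Nat.sub_sub_self (hyu.trans hux), Nat.sub_sub_self hyu, Nat.sub_sub_self hux]
  split_ifs
  · rw [← Finset.Ioc_union_Ioc_eq_Ioc hyu hux,
      Finset.sum_union (Finset.Ioc_disjoint_Ioc_of_le le_rfl)]
    push_cast; ring
  · ring

/-- The empty interval: `gallagherTerm χ u 0 = 0`. [folklore] -/
theorem gallagherTerm_zero {q : ℕ} (χ : DirichletCharacter ℂ q) (u : ℕ) : gallagherTerm χ u 0 = 0 := by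
  simp [gallagherTerm, charPrimeSum]

open scoped Classical in
/-- The empty interval: `gallagherTermExc χ̃ β χ u 0 = 0`. [folklore] -/
theorem gallagherTermExc_zero {r : ℕ} (χe : DirichletCharacter ℂ r) (β : ℝ) {q : ℕ}
    (χ : DirichletCharacter ℂ q) (u : ℕ) : gallagherTermExc χe β χ u 0 = 0 := by
  simp [gallagherTermExc, gallagherTerm_zero]

/-- The left piece `(y, max(y, u₀)]` is empty or short: `‖gallagherTerm χ u (u − y)‖ ≤ (log 4 + 1) u₀`
for `u = max y u₀`. [folklore] -/
theorem norm_gallagherTerm_left_le {q : ℕ} (χ : DirichletCharacter ℂ q) (y u₀ : ℕ) :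
    ‖gallagherTerm χ (max y u₀) (max y u₀ - y)‖ ≤ (Real.log 4 + 1) * u₀ := by
  rcases le_total u₀ y with h | h
  · rw [max_eq_left h, Nat.sub_self, gallagherTerm_zero, norm_zero]
    have : 0 ≤ Real.log 4 := Real.log_nonneg (by norm_num)
    positivity
  · rw [max_eq_right h]
    exact norm_gallagherTerm_le χ u₀ (u₀ - y)

open scoped Classical in
/-- The same with correction (`β ≤ 1`): `‖gallagherTermExc χ̃ β χ u (u − y)‖ ≤ (log 4 + 2) u₀`.
[folklore] -/
theorem norm_gallagherTermExc_left_le {r : ℕ} (χe : DirichletCharacter ℂ r) {β : ℝ} (hβ : β ≤ 1)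
    {q : ℕ} (χ : DirichletCharacter ℂ q) (y u₀ : ℕ) :
    ‖gallagherTermExc χe β χ (max y u₀) (max y u₀ - y)‖ ≤ (Real.log 4 + 2) * u₀ := by
  rcases le_total u₀ y with h | h
  · rw [max_eq_left h, Nat.sub_self, gallagherTermExc_zero, norm_zero]
    have : 0 ≤ Real.log 4 := Real.log_nonneg (by norm_num)
    positivity
  · rw [max_eq_right h]
    exact norm_gallagherTermExc_le χe hβ χ u₀ (u₀ - y)

/-! ### The error quantity is monotone in the scale -/

/-- `2√v log v + 2 log(v+1) + K(log v + (v/T) log²(qvT)) ≤ 2√N log N + 2 log(N+1) + K(log N + (N/T) log²(PNT))`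
for `2 ≤ v ≤ N`, `1 ≤ q ≤ P`, `T ≥ 2`, `K ≥ 0`. [folklore] -/
theorem blockError_mono {v N q P T K : ℝ} (hv : 2 ≤ v) (hvN : v ≤ N) (hq : 1 ≤ q) (hqP : q ≤ P)
    (hT : 2 ≤ T) (hK : 0 ≤ K) :
    2 * Real.sqrt v * Real.log v + 2 * Real.log (v + 1) + K * (Real.log v + v / T * Real.log (q * v * T) ^ 2) ≤
      2 * Real.sqrt N * Real.log N + 2 * Real.log (N + 1) +
        K * (Real.log N + N / T * Real.log (P * N * T) ^ 2) := by
  have hv0 : 0 < v := by linarith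
  have hN0 : 0 < N := by linarith
  have hq0 : 0 < q := by linarith
  have hT0 : 0 < T := by linarith
  have hlogv : 0 ≤ Real.log v := Real.log_nonneg (by linarith)
  have h1 : Real.log v ≤ Real.log N := Real.log_le_log hv0 hvN
  have h2 : Real.sqrt v ≤ Real.sqrt N := Real.sqrt_le_sqrt hvN
  have h3 : Real.log (v + 1) ≤ Real.log (N + 1) := Real.log_le_log (by linarith) (by linarith)
  have hqvT : 1 ≤ q * v * T :=
    one_le_mul_of_one_le_of_one_le (one_le_mul_of_one_le_of_one_le hq (by linarith)) (by linarith)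
  have hlog0 : 0 ≤ Real.log (q * v * T) := Real.log_nonneg hqvT
  have h4 : Real.log (q * v * T) ≤ Real.log (P * N * T) := by
    apply Real.log_le_log (by positivity)
    have : q * v ≤ P * N := mul_le_mul hqP hvN hv0.le (by linarith)
    exact mul_le_mul_of_nonneg_right this hT0.le
  have h5 : Real.log (q * v * T) ^ 2 ≤ Real.log (P * N * T) ^ 2 := pow_le_pow_left₀ hlog0 h4 2
  have h6 : v / T ≤ N / T := div_le_div_of_nonneg_right hvN hT0.le
  have h7 : v / T * Real.log (q * v * T) ^ 2 ≤ N / T * Real.log (P * N * T) ^ 2 :=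
    mul_le_mul h6 h5 (sq_nonneg _) (by positivity)
  have h8 : Real.sqrt v * Real.log v ≤ Real.sqrt N * Real.log N :=
    mul_le_mul h2 h1 hlogv (Real.sqrt_nonneg _)
  nlinarith [mul_le_mul_of_nonneg_left (add_le_add h1 h7) hK]

/-! ### The weight -/

/-- `(h + N/P)⁻¹ a + (h + N/P)⁻¹ b ≤ (P/N) a + h'⁻¹·… `: the two uses of the weight,
`(h + D)⁻¹ ≤ D⁻¹` and `(h + D)⁻¹ t ≤ 1` for `t ≤ h`. [folklore] -/
theorem weight_mul_le {h D a t U : ℝ} (hh : 0 ≤ h) (hD : 0 < D) (ha : 0 ≤ a)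
    (hth : t ≤ h) (hU : 0 ≤ U) :
    (h + D)⁻¹ * (a + t * U) ≤ D⁻¹ * a + U := by
  have hden : 0 < h + D := by linarith
  have h1 : (h + D)⁻¹ * a ≤ D⁻¹ * a :=
    mul_le_mul_of_nonneg_right (inv_anti₀ hD (by linarith)) ha
  have h2 : (h + D)⁻¹ * (t * U) ≤ U := by
    rw [inv_mul_le_iff₀ hden]
    nlinarith
  calc (h + D)⁻¹ * (a + t * U) = (h + D)⁻¹ * a + (h + D)⁻¹ * (t * U) := by ring
    _ ≤ D⁻¹ * a + U := add_le_add h1 h2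

/-! ### The weighted term for `χ` primitive mod `q ≥ 2` -/

/-- **The weighted term of (4.2) for `χ` primitive mod `2 ≤ q ≤ P`.** Assume the block estimate
(`exists_block_bound_char`, unpacked, constant `K ≥ 0`). Let `2 ≤ P`, `2 ≤ T`, `2 ≤ u₀ ≤ N`,
`x, h ≤ N`. Then
`(h + N/P)⁻¹ ‖gallagherTerm χ x h‖ ≤ ∑_{ρ ∈ box(T)} m(ρ) u₀^{Re ρ − 1} + (P/N)((log 4 + 2)u₀ + E)`,
`E = 2√N log N + 2 log(N+1) + K(log N + (N/T) log²(PNT))`. (Gallagher 1970 §5 / M–V Lemma 4.3: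
the zeros enter through `|(x^ρ − u^ρ)/ρ| ≤ (x − u) u^{β−1}`, `u ≥ u₀`.)
[cite: MontgomeryVaughanActa1975, §4 Lemma 4.3] [cite: Gallagher1970, §5] -/
theorem weighted_gallagherTerm_le {K : ℝ} (hK0 : 0 ≤ K)
    (HK : ∀ (q : ℕ) [NeZero q], 1 < q → ∀ χ : DirichletCharacter ℂ q, χ.IsPrimitive →
      ∀ u v : ℕ, 2 ≤ u → u ≤ v → ∀ T : ℝ, 2 ≤ T →
        ‖charPrimeSum χ v (v - u) + (charZeroSumTrunc χ v T - charZeroSumTrunc χ u T)‖ ≤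
          2 * Real.sqrt v * Real.log v + 2 * Real.log (v + 1) +
            K * (Real.log v + v / T * Real.log (q * v * T) ^ 2))
    {N : ℕ} {P T : ℝ} (hP : 2 ≤ P) (hT : 2 ≤ T) {q : ℕ} [NeZero q] (hq : 1 < q)
    (hqP : (q : ℝ) ≤ P) {χ : DirichletCharacter ℂ q} (hprim : χ.IsPrimitive) (hχ : χ ≠ 1)
    {u₀ : ℕ} (hu₀ : 2 ≤ u₀) (hu₀N : u₀ ≤ N) {x h : ℕ} (hx : x ≤ N) :
    ((h : ℝ) + N / P)⁻¹ * ‖gallagherTerm χ x h‖ ≤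
      (∑ ρ ∈ (lfunctionZeroBox_finite hχ T).toFinset,
          (DirichletDisc.zeroOrder χ ρ : ℝ) * (u₀ : ℝ) ^ (ρ.re - 1)) +
        P / N * ((Real.log 4 + 2) * u₀ +
          (2 * Real.sqrt N * Real.log N + 2 * Real.log (N + 1) +
            K * (Real.log N + N / T * Real.log (P * N * T) ^ 2))) := by
  have hP0 : 0 < P := by linarith
  have hN1 : (1 : ℝ) ≤ N := by exact_mod_cast (show 1 ≤ N by omega)
  have hN0 : (0 : ℝ) < N := by linarith
  have hNP : 0 < (N : ℝ) / P := div_pos hN0 hP0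
  have hq1 : (1 : ℝ) ≤ q := by exact_mod_cast hq.le
  set S := (lfunctionZeroBox_finite hχ T).toFinset with hS
  set U : ℝ := ∑ ρ ∈ S, (DirichletDisc.zeroOrder χ ρ : ℝ) * (u₀ : ℝ) ^ (ρ.re - 1) with hU
  set E : ℝ := 2 * Real.sqrt N * Real.log N + 2 * Real.log (N + 1) +
    K * (Real.log N + N / T * Real.log (P * N * T) ^ 2) with hE
  have hU0 : 0 ≤ U := Finset.sum_nonneg fun ρ _ => by positivity
  have hlog4 : 0 ≤ Real.log 4 := Real.log_nonneg (by norm_num)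
  have hE0 : 0 ≤ E := by
    have h1 : 0 ≤ Real.log (N : ℝ) := Real.log_nonneg hN1
    have h2 : 0 ≤ Real.log ((N : ℝ) + 1) := Real.log_nonneg (by linarith)
    have hT0 : 0 < T := by linarith
    positivity
  have hPN : ((h : ℝ) + N / P)⁻¹ ≤ P / N := by
    calc ((h : ℝ) + N / P)⁻¹ ≤ ((N : ℝ) / P)⁻¹ :=
          inv_anti₀ hNP (by linarith [(Nat.cast_nonneg h : (0 : ℝ) ≤ h)])
      _ = P / N := by rw [inv_div]
  have hw0 : 0 ≤ ((h : ℝ) + N / P)⁻¹ := by positivity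
  rcases lt_or_ge x u₀ with hxu | hxu
  · -- short intervals: trivial bound
    have htriv := norm_gallagherTerm_le χ x h
    have hxu' : (x : ℝ) ≤ u₀ := by exact_mod_cast hxu.le
    calc ((h : ℝ) + N / P)⁻¹ * ‖gallagherTerm χ x h‖
        ≤ (P / N) * ((Real.log 4 + 1) * u₀) := by
          apply mul_le_mul hPN (htriv.trans (mul_le_mul_of_nonneg_left hxu' (by linarith)))
            (norm_nonneg _) (by positivity)
      _ ≤ U + P / N * ((Real.log 4 + 2) * u₀ + E) := by
          have : (Real.log 4 + 1) * (u₀ : ℝ) ≤ (Real.log 4 + 2) * u₀ + E := by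
            have : (0 : ℝ) ≤ u₀ := Nat.cast_nonneg _
            linarith
          have hPN0 : 0 ≤ P / N := by positivity
          linarith [mul_le_mul_of_nonneg_left this hPN0]
  · -- `x ≥ u₀`: cut `(y, x]` at `u = max y u₀`
    set y : ℕ := x - h with hy
    set u : ℕ := max y u₀ with hu
    have hyx : y ≤ x := Nat.sub_le x h
    have hyu : y ≤ u := le_max_left _ _
    have hux : u ≤ x := max_le hyx hxu
    have hu₀u : u₀ ≤ u := le_max_right _ _
    have hu2 : 2 ≤ u := hu₀.trans hu₀u
    have hxy : x - (x - y) = x - h := by rw [hy]; omega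
    have hsplit : gallagherTerm χ x h = gallagherTerm χ u (u - y) + gallagherTerm χ x (x - u) := by
      rw [← gallagherTerm_congr χ hxy, gallagherTerm_split χ hyu hux]
    -- the left piece
    have hleft : ‖gallagherTerm χ u (u - y)‖ ≤ (Real.log 4 + 1) * u₀ := by
      rw [hu]; exact norm_gallagherTerm_left_le χ y u₀
    -- the right piece: block estimate and the zeros
    have hq1' : ¬ (q = 1) := by omega
    have hright_eq : gallagherTerm χ x (x - u) = charPrimeSum χ x (x - u) := by
      rw [gallagherTerm, if_neg hq1', sub_zero]
    have hblock := HK q hq χ hprim u x hu2 hux T hT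
    have hE_le : 2 * Real.sqrt x * Real.log x + 2 * Real.log (x + 1) +
        K * (Real.log x + x / T * Real.log (q * x * T) ^ 2) ≤ E :=
      blockError_mono (by exact_mod_cast (hu2.trans hux)) (by exact_mod_cast hx) hq1 hqP hT hK0
    have hu0' : (0 : ℝ) < u := by exact_mod_cast (show 0 < u by omega)
    have hux' : (u : ℝ) ≤ x := by exact_mod_cast hux
    have hZ : ‖charZeroSumTrunc χ x T - charZeroSumTrunc χ u T‖ ≤ ((x : ℝ) - u) * U := by
      rw [charZeroSumTrunc_sub hχ]
      refine (norm_sum_mul_cpow_sub_div_le S _ hu0' hux' (fun ρ _ => Nat.cast_nonneg _)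
        (fun ρ hρ => ne_zero_and_re_le_of_mem hχ hρ)).trans ?_
      refine mul_le_mul_of_nonneg_left ?_ (by linarith)
      exact sum_mul_rpow_le_of_le S _ (by exact_mod_cast (show 0 < u₀ by omega))
        (by exact_mod_cast hu₀u) (fun ρ _ => Nat.cast_nonneg _)
        (fun ρ hρ => (ne_zero_and_re_le_of_mem hχ hρ).2)
    have hright : ‖gallagherTerm χ x (x - u)‖ ≤ E + ((x : ℝ) - u) * U := by
      rw [hright_eq]
      have h1 : charPrimeSum χ x (x - u) =
          (charPrimeSum χ x (x - u) + (charZeroSumTrunc χ x T - charZeroSumTrunc χ u T)) -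
            (charZeroSumTrunc χ x T - charZeroSumTrunc χ u T) := by ring
      rw [h1]
      refine (norm_sub_le _ _).trans ?_
      linarith [hblock, hE_le, hZ]
    -- the weight
    have ht : ((x : ℝ) - u) ≤ h := by
      have h1 : (u : ℝ) ≥ y := by exact_mod_cast hyu
      have h2 : ((y : ℕ) : ℝ) ≥ (x : ℝ) - h := by
        rw [hy]
        rcases le_total h x with hh | hh
        · rw [Nat.cast_sub hh]
        · rw [Nat.sub_eq_zero_of_le hh]; push_cast; linarith [(Nat.cast_le.mpr hh : (x:ℝ) ≤ h)]
      linarith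
    calc ((h : ℝ) + N / P)⁻¹ * ‖gallagherTerm χ x h‖
        ≤ ((h : ℝ) + N / P)⁻¹ * (((Real.log 4 + 1) * u₀ + E) + ((x : ℝ) - u) * U) := by
          apply mul_le_mul_of_nonneg_left _ hw0
          rw [hsplit]
          refine (norm_add_le _ _).trans ?_
          linarith [hleft, hright]
      _ ≤ ((N : ℝ) / P)⁻¹ * ((Real.log 4 + 1) * u₀ + E) + U :=
          weight_mul_le (Nat.cast_nonneg h) hNP (by positivity) ht hU0
      _ ≤ U + P / N * ((Real.log 4 + 2) * u₀ + E) := by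
          rw [inv_div]
          have : (Real.log 4 + 1) * (u₀ : ℝ) + E ≤ (Real.log 4 + 2) * u₀ + E := by
            have : (0 : ℝ) ≤ u₀ := Nat.cast_nonneg _
            linarith
          have hPN0 : 0 ≤ P / N := by positivity
          linarith [mul_le_mul_of_nonneg_left this hPN0]

/-! ### The weighted term for the character modulo `1` -/

/-- Error monotonicity for the `ζ`-block. [folklore] -/
theorem blockErrorZeta_mono {v N T C : ℝ} (hv : 2 ≤ v) (hvN : v ≤ N) (hT : 2 ≤ T) (hC : 0 ≤ C) :
    2 * Real.sqrt v * Real.log v + 2 * Real.log v + 1 + C * (Real.log v + v / T * Real.log (v * T) ^ 2) ≤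
      2 * Real.sqrt N * Real.log N + 2 * Real.log N + 1 +
        C * (Real.log N + N / T * Real.log (N * T) ^ 2) := by
  have hv0 : 0 < v := by linarith
  have hN0 : 0 < N := by linarith
  have hT0 : 0 < T := by linarith
  have hlogv : 0 ≤ Real.log v := Real.log_nonneg (by linarith)
  have h1 : Real.log v ≤ Real.log N := Real.log_le_log hv0 hvN
  have h2 : Real.sqrt v ≤ Real.sqrt N := Real.sqrt_le_sqrt hvN
  have hvT : 1 ≤ v * T := one_le_mul_of_one_le_of_one_le (by linarith) (by linarith)
  have hlog0 : 0 ≤ Real.log (v * T) := Real.log_nonneg hvT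
  have h4 : Real.log (v * T) ≤ Real.log (N * T) :=
    Real.log_le_log (by positivity) (mul_le_mul_of_nonneg_right hvN hT0.le)
  have h5 : Real.log (v * T) ^ 2 ≤ Real.log (N * T) ^ 2 := pow_le_pow_left₀ hlog0 h4 2
  have h6 : v / T ≤ N / T := div_le_div_of_nonneg_right hvN hT0.le
  have h7 : v / T * Real.log (v * T) ^ 2 ≤ N / T * Real.log (N * T) ^ 2 :=
    mul_le_mul h6 h5 (sq_nonneg _) (by positivity)
  have h8 : Real.sqrt v * Real.log v ≤ Real.sqrt N * Real.log N :=
    mul_le_mul h2 h1 hlogv (Real.sqrt_nonneg _)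
  nlinarith [mul_le_mul_of_nonneg_left (add_le_add h1 h7) hC]

/-- **The weighted term of (4.2) for the character modulo `1`** (the zeros of `ζ`,
`weilZeroIndex T`): assuming the `ζ`-block estimate (`exists_block_bound_zeta`, unpacked, constant
`C ≥ 0`), for `2 ≤ P`, `2 ≤ T`, `2 ≤ u₀ ≤ N`, `x, h ≤ N`,
`(h + N/P)⁻¹ ‖gallagherTerm χ x h‖ ≤ ∑_{ρ} m(ρ) u₀^{Re ρ − 1} + (P/N)((log 4 + 2)u₀ + E_ζ)`,
`E_ζ = 2√N log N + 2 log N + 1 + C(log N + (N/T) log²(NT))`.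
[cite: MontgomeryVaughanActa1975, §4 Lemma 4.3] [cite: Gallagher1970, §5] -/
theorem weighted_gallagherTerm_modOne_le {C : ℝ} (hC0 : 0 ≤ C)
    (HC : ∀ (χ : DirichletCharacter ℂ 1) (u v : ℕ), 2 ≤ u → u ≤ v → ∀ T : ℝ, 2 ≤ T →
      ‖gallagherTerm χ v (v - u) + (zetaZeroSumTrunc v T - zetaZeroSumTrunc u T)‖ ≤
        2 * Real.sqrt v * Real.log v + 2 * Real.log v + 1 +
          C * (Real.log v + v / T * Real.log (v * T) ^ 2))
    {N : ℕ} {P T : ℝ} (hP : 2 ≤ P) (hT : 2 ≤ T) (χ : DirichletCharacter ℂ 1)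
    {u₀ : ℕ} (hu₀ : 2 ≤ u₀) (hu₀N : u₀ ≤ N) {x h : ℕ} (hx : x ≤ N) :
    ((h : ℝ) + N / P)⁻¹ * ‖gallagherTerm χ x h‖ ≤
      (∑ ρ ∈ (weilZeroIndex_finite T).toFinset,
          ((riemannZetaZeroOrder ρ : ℤ) : ℝ) * (u₀ : ℝ) ^ (ρ.re - 1)) +
        P / N * ((Real.log 4 + 2) * u₀ +
          (2 * Real.sqrt N * Real.log N + 2 * Real.log N + 1 +
            C * (Real.log N + N / T * Real.log (N * T) ^ 2))) := by
  have hP0 : 0 < P := by linarith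
  have hN1 : (1 : ℝ) ≤ N := by exact_mod_cast (show 1 ≤ N by omega)
  have hN0 : (0 : ℝ) < N := by linarith
  have hNP : 0 < (N : ℝ) / P := div_pos hN0 hP0
  set S := (weilZeroIndex_finite T).toFinset with hS
  set U : ℝ := ∑ ρ ∈ S, ((riemannZetaZeroOrder ρ : ℤ) : ℝ) * (u₀ : ℝ) ^ (ρ.re - 1) with hU
  set E : ℝ := 2 * Real.sqrt N * Real.log N + 2 * Real.log N + 1 +
    C * (Real.log N + N / T * Real.log (N * T) ^ 2) with hE
  have hm0 : ∀ ρ ∈ S, 0 ≤ ((riemannZetaZeroOrder ρ : ℤ) : ℝ) := fun ρ hρ =>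
    (mem_toFinset_weilZeroIndex hρ).2.2.2.2.2.2.2
  have hU0 : 0 ≤ U := Finset.sum_nonneg fun ρ hρ => by
    have := hm0 ρ hρ
    positivity
  have hlog4 : 0 ≤ Real.log 4 := Real.log_nonneg (by norm_num)
  have hE0 : 0 ≤ E := by
    have h1 : 0 ≤ Real.log (N : ℝ) := Real.log_nonneg hN1
    have hT0 : 0 < T := by linarith
    positivity
  have hPN : ((h : ℝ) + N / P)⁻¹ ≤ P / N := by
    calc ((h : ℝ) + N / P)⁻¹ ≤ ((N : ℝ) / P)⁻¹ :=
          inv_anti₀ hNP (by linarith [(Nat.cast_nonneg h : (0 : ℝ) ≤ h)])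
      _ = P / N := by rw [inv_div]
  have hw0 : 0 ≤ ((h : ℝ) + N / P)⁻¹ := by positivity
  rcases lt_or_ge x u₀ with hxu | hxu
  · have htriv := norm_gallagherTerm_le χ x h
    have hxu' : (x : ℝ) ≤ u₀ := by exact_mod_cast hxu.le
    calc ((h : ℝ) + N / P)⁻¹ * ‖gallagherTerm χ x h‖
        ≤ (P / N) * ((Real.log 4 + 1) * u₀) := by
          apply mul_le_mul hPN (htriv.trans (mul_le_mul_of_nonneg_left hxu' (by linarith)))
            (norm_nonneg _) (by positivity)
      _ ≤ U + P / N * ((Real.log 4 + 2) * u₀ + E) := by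
          have : (Real.log 4 + 1) * (u₀ : ℝ) ≤ (Real.log 4 + 2) * u₀ + E := by
            have : (0 : ℝ) ≤ u₀ := Nat.cast_nonneg _
            linarith
          have hPN0 : 0 ≤ P / N := by positivity
          linarith [mul_le_mul_of_nonneg_left this hPN0]
  · set y : ℕ := x - h with hy
    set u : ℕ := max y u₀ with hu
    have hyx : y ≤ x := Nat.sub_le x h
    have hyu : y ≤ u := le_max_left _ _
    have hux : u ≤ x := max_le hyx hxu
    have hu₀u : u₀ ≤ u := le_max_right _ _
    have hu2 : 2 ≤ u := hu₀.trans hu₀u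
    have hxy : x - (x - y) = x - h := by rw [hy]; omega
    have hsplit : gallagherTerm χ x h = gallagherTerm χ u (u - y) + gallagherTerm χ x (x - u) := by
      rw [← gallagherTerm_congr χ hxy, gallagherTerm_split χ hyu hux]
    have hleft : ‖gallagherTerm χ u (u - y)‖ ≤ (Real.log 4 + 1) * u₀ := by
      rw [hu]; exact norm_gallagherTerm_left_le χ y u₀
    have hblock := HC χ u x hu2 hux T hT
    have hE_le : 2 * Real.sqrt x * Real.log x + 2 * Real.log x + 1 +
        C * (Real.log x + x / T * Real.log (x * T) ^ 2) ≤ E :=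
      blockErrorZeta_mono (by exact_mod_cast (hu2.trans hux)) (by exact_mod_cast hx) hT hC0
    have hu0' : (0 : ℝ) < u := by exact_mod_cast (show 0 < u by omega)
    have hux' : (u : ℝ) ≤ x := by exact_mod_cast hux
    have hZ : ‖zetaZeroSumTrunc x T - zetaZeroSumTrunc u T‖ ≤ ((x : ℝ) - u) * U := by
      rw [zetaZeroSumTrunc_sub]
      refine (norm_sum_mul_cpow_sub_div_le S _ hu0' hux' hm0
        (fun ρ hρ => ⟨(mem_toFinset_weilZeroIndex hρ).2.2.2.2.2.1,
          (mem_toFinset_weilZeroIndex hρ).2.2.1⟩)).trans ?_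
      refine mul_le_mul_of_nonneg_left ?_ (by linarith)
      exact sum_mul_rpow_le_of_le S _ (by exact_mod_cast (show 0 < u₀ by omega))
        (by exact_mod_cast hu₀u) hm0 (fun ρ hρ => (mem_toFinset_weilZeroIndex hρ).2.2.1)
    have hright : ‖gallagherTerm χ x (x - u)‖ ≤ E + ((x : ℝ) - u) * U := by
      have h1 : gallagherTerm χ x (x - u) =
          (gallagherTerm χ x (x - u) + (zetaZeroSumTrunc x T - zetaZeroSumTrunc u T)) -
            (zetaZeroSumTrunc x T - zetaZeroSumTrunc u T) := by ring
      rw [h1]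
      refine (norm_sub_le _ _).trans ?_
      linarith [hblock, hE_le, hZ]
    have ht : ((x : ℝ) - u) ≤ h := by
      have h1 : (u : ℝ) ≥ y := by exact_mod_cast hyu
      have h2 : ((y : ℕ) : ℝ) ≥ (x : ℝ) - h := by
        rw [hy]
        rcases le_total h x with hh | hh
        · rw [Nat.cast_sub hh]
        · rw [Nat.sub_eq_zero_of_le hh]; push_cast; linarith [(Nat.cast_le.mpr hh : (x:ℝ) ≤ h)]
      linarith
    calc ((h : ℝ) + N / P)⁻¹ * ‖gallagherTerm χ x h‖
        ≤ ((h : ℝ) + N / P)⁻¹ * (((Real.log 4 + 1) * u₀ + E) + ((x : ℝ) - u) * U) := by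
          apply mul_le_mul_of_nonneg_left _ hw0
          rw [hsplit]
          refine (norm_add_le _ _).trans ?_
          linarith [hleft, hright]
      _ ≤ ((N : ℝ) / P)⁻¹ * ((Real.log 4 + 1) * u₀ + E) + U :=
          weight_mul_le (Nat.cast_nonneg h) hNP (by positivity) ht hU0
      _ ≤ U + P / N * ((Real.log 4 + 2) * u₀ + E) := by
          rw [inv_div]
          have : (Real.log 4 + 1) * (u₀ : ℝ) + E ≤ (Real.log 4 + 2) * u₀ + E := by
            have : (0 : ℝ) ≤ u₀ := Nat.cast_nonneg _
            linarith
          have hPN0 : 0 ≤ P / N := by positivity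
          linarith [mul_le_mul_of_nonneg_left this hPN0]

/-! ### The weighted term for the exceptional character itself -/

open scoped Classical in
/-- **The weighted term of (4.2) for the exceptional character `χ̃` with its correction** (the
term `∑_{x−h<p≤x} χ̃(p) log p + ∑_{x−h<n≤x} n^{β̃−1}`): if `ρ₀ = β̃` (`0 < β̃ ≤ 1`) is a SIMPLE zero of
`L(s, χ̃)` in the box (`ρ₀ ∈ box(T)`, `m(ρ₀) = 1`), then
`(h + N/P)⁻¹ ‖gallagherTermExc χ̃ β̃ χ̃ x h‖ ≤ ∑_{ρ ≠ ρ₀} m(ρ) u₀^{Re ρ − 1} + (P/N)((log 4 + 2)u₀ + E + 1)`: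
the term `(x^{β̃} − u^{β̃})/β̃` of `ρ₀` in `Z(x) − Z(u)` cancels against the correction up to `1`
(`norm_sum_rpow_sub_cpow_div_le`). [cite: MontgomeryVaughanActa1975, §4 Lemma 4.3] [cite: Gallagher1970, §5] -/
theorem weighted_gallagherTermExc_self_le {K : ℝ} (hK0 : 0 ≤ K)
    (HK : ∀ (q : ℕ) [NeZero q], 1 < q → ∀ χ : DirichletCharacter ℂ q, χ.IsPrimitive →
      ∀ u v : ℕ, 2 ≤ u → u ≤ v → ∀ T : ℝ, 2 ≤ T →
        ‖charPrimeSum χ v (v - u) + (charZeroSumTrunc χ v T - charZeroSumTrunc χ u T)‖ ≤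
          2 * Real.sqrt v * Real.log v + 2 * Real.log (v + 1) +
            K * (Real.log v + v / T * Real.log (q * v * T) ^ 2))
    {N : ℕ} {P T : ℝ} (hP : 2 ≤ P) (hT : 2 ≤ T) {r : ℕ} [NeZero r] (hr : 1 < r)
    (hrP : (r : ℝ) ≤ P) {χe : DirichletCharacter ℂ r} (hprim : χe.IsPrimitive) (hχe : χe ≠ 1)
    {β : ℝ} (hβ0 : 0 < β) (hβ1 : β ≤ 1)
    (hmem : ((β : ℝ) : ℂ) ∈ (lfunctionZeroBox_finite hχe T).toFinset)
    (hsimple : DirichletDisc.zeroOrder χe ((β : ℝ) : ℂ) = 1)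
    {u₀ : ℕ} (hu₀ : 2 ≤ u₀) (hu₀N : u₀ ≤ N) {x h : ℕ} (hx : x ≤ N) :
    ((h : ℝ) + N / P)⁻¹ * ‖gallagherTermExc χe β χe x h‖ ≤
      (∑ ρ ∈ ((lfunctionZeroBox_finite hχe T).toFinset).erase ((β : ℝ) : ℂ),
          (DirichletDisc.zeroOrder χe ρ : ℝ) * (u₀ : ℝ) ^ (ρ.re - 1)) +
        P / N * ((Real.log 4 + 2) * u₀ +
          (2 * Real.sqrt N * Real.log N + 2 * Real.log (N + 1) +
            K * (Real.log N + N / T * Real.log (P * N * T) ^ 2)) + 1) := by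
  have hP0 : 0 < P := by linarith
  have hN1 : (1 : ℝ) ≤ N := by exact_mod_cast (show 1 ≤ N by omega)
  have hN0 : (0 : ℝ) < N := by linarith
  have hNP : 0 < (N : ℝ) / P := div_pos hN0 hP0
  have hr1 : (1 : ℝ) ≤ r := by exact_mod_cast hr.le
  set ρ₀ : ℂ := ((β : ℝ) : ℂ) with hρ₀
  set S := (lfunctionZeroBox_finite hχe T).toFinset with hS
  set S' := S.erase ρ₀ with hS'
  set U : ℝ := ∑ ρ ∈ S', (DirichletDisc.zeroOrder χe ρ : ℝ) * (u₀ : ℝ) ^ (ρ.re - 1) with hU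
  set E : ℝ := 2 * Real.sqrt N * Real.log N + 2 * Real.log (N + 1) +
    K * (Real.log N + N / T * Real.log (P * N * T) ^ 2) with hE
  have hU0 : 0 ≤ U := Finset.sum_nonneg fun ρ _ => by positivity
  have hlog4 : 0 ≤ Real.log 4 := Real.log_nonneg (by norm_num)
  have hE0 : 0 ≤ E := by
    have h1 : 0 ≤ Real.log (N : ℝ) := Real.log_nonneg hN1
    have h2 : 0 ≤ Real.log ((N : ℝ) + 1) := Real.log_nonneg (by linarith)
    have hT0 : 0 < T := by linarith
    positivity
  have hPN : ((h : ℝ) + N / P)⁻¹ ≤ P / N := by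
    calc ((h : ℝ) + N / P)⁻¹ ≤ ((N : ℝ) / P)⁻¹ :=
          inv_anti₀ hNP (by linarith [(Nat.cast_nonneg h : (0 : ℝ) ≤ h)])
      _ = P / N := by rw [inv_div]
  have hw0 : 0 ≤ ((h : ℝ) + N / P)⁻¹ := by positivity
  have hS'sub : S' ⊆ S := Finset.erase_subset _ _
  rcases lt_or_ge x u₀ with hxu | hxu
  · have htriv := norm_gallagherTermExc_le χe hβ1 χe x h
    have hxu' : (x : ℝ) ≤ u₀ := by exact_mod_cast hxu.le
    calc ((h : ℝ) + N / P)⁻¹ * ‖gallagherTermExc χe β χe x h‖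
        ≤ (P / N) * ((Real.log 4 + 2) * u₀) := by
          apply mul_le_mul hPN (htriv.trans (mul_le_mul_of_nonneg_left hxu' (by linarith)))
            (norm_nonneg _) (by positivity)
      _ ≤ U + P / N * ((Real.log 4 + 2) * u₀ + E + 1) := by
          have hPN0 : 0 ≤ P / N := by positivity
          linarith [mul_le_mul_of_nonneg_left (show (Real.log 4 + 2) * (u₀ : ℝ) ≤
            (Real.log 4 + 2) * u₀ + E + 1 by linarith) hPN0]
  · set y : ℕ := x - h with hy
    set u : ℕ := max y u₀ with hu
    have hyx : y ≤ x := Nat.sub_le x h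
    have hyu : y ≤ u := le_max_left _ _
    have hux : u ≤ x := max_le hyx hxu
    have hu₀u : u₀ ≤ u := le_max_right _ _
    have hu2 : 2 ≤ u := hu₀.trans hu₀u
    have hu1 : 1 ≤ u := by omega
    have hxy : x - (x - y) = x - h := by rw [hy]; omega
    have hsplit : gallagherTermExc χe β χe x h =
        gallagherTermExc χe β χe u (u - y) + gallagherTermExc χe β χe x (x - u) := by
      rw [← gallagherTermExc_congr χe β χe hxy, gallagherTermExc_split χe β χe hyu hux]
    have hleft : ‖gallagherTermExc χe β χe u (u - y)‖ ≤ (Real.log 4 + 2) * u₀ := by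
      rw [hu]; exact norm_gallagherTermExc_left_le χe hβ1 χe y u₀
    -- the right piece `cps + ∑ n^{β−1}`
    have hr1' : ¬ (r = 1) := by omega
    have hright_eq : gallagherTermExc χe β χe x (x - u) =
        charPrimeSum χe x (x - u) + ((∑ n ∈ Ioc u x, (n : ℝ) ^ (β - 1) : ℝ) : ℂ) := by
      rw [gallagherTermExc, gallagherTerm, if_neg hr1', sub_zero, if_pos ⟨rfl, fun n => rfl⟩,
        Nat.sub_sub_self hux]
    have hblock := HK r hr χe hprim u x hu2 hux T hT
    have hE_le : 2 * Real.sqrt x * Real.log x + 2 * Real.log (x + 1) +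
        K * (Real.log x + x / T * Real.log (r * x * T) ^ 2) ≤ E :=
      blockError_mono (by exact_mod_cast (hu2.trans hux)) (by exact_mod_cast hx) hr1 hrP hT hK0
    have hu0' : (0 : ℝ) < u := by exact_mod_cast (show 0 < u by omega)
    have hux' : (u : ℝ) ≤ x := by exact_mod_cast hux
    -- split the zero sum at `ρ₀`
    have hZsplit : charZeroSumTrunc χe x T - charZeroSumTrunc χe u T =
        ((((x : ℝ) : ℂ) ^ ρ₀ - ((u : ℝ) : ℂ) ^ ρ₀) / ρ₀) +
          ∑ ρ ∈ S', ((DirichletDisc.zeroOrder χe ρ : ℝ) : ℂ) *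
            ((((x : ℝ) : ℂ) ^ ρ - ((u : ℝ) : ℂ) ^ ρ) / ρ) := by
      rw [charZeroSumTrunc_sub hχe, ← hS, ← Finset.add_sum_erase S _ hmem, ← hS', hsimple]
      push_cast
      ring
    have hZ' : ‖∑ ρ ∈ S', ((DirichletDisc.zeroOrder χe ρ : ℝ) : ℂ) *
        ((((x : ℝ) : ℂ) ^ ρ - ((u : ℝ) : ℂ) ^ ρ) / ρ)‖ ≤ ((x : ℝ) - u) * U := by
      refine (norm_sum_mul_cpow_sub_div_le S' _ hu0' hux' (fun ρ _ => Nat.cast_nonneg _)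
        (fun ρ hρ => ne_zero_and_re_le_of_mem hχe (hS'sub hρ))).trans ?_
      refine mul_le_mul_of_nonneg_left ?_ (by linarith)
      exact sum_mul_rpow_le_of_le S' _ (by exact_mod_cast (show 0 < u₀ by omega))
        (by exact_mod_cast hu₀u) (fun ρ _ => Nat.cast_nonneg _)
        (fun ρ hρ => (ne_zero_and_re_le_of_mem hχe (hS'sub hρ)).2)
    have hcorr : ‖((∑ n ∈ Ioc u x, (n : ℝ) ^ (β - 1) : ℝ) : ℂ) -
        ((((x : ℝ) : ℂ) ^ ρ₀ - ((u : ℝ) : ℂ) ^ ρ₀) / ρ₀)‖ ≤ 1 := by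
      rw [hρ₀]
      exact norm_sum_rpow_sub_cpow_div_le hu1 hux hβ0 hβ1
    have hright : ‖gallagherTermExc χe β χe x (x - u)‖ ≤ E + ((x : ℝ) - u) * U + 1 := by
      rw [hright_eq]
      have h1 : charPrimeSum χe x (x - u) + ((∑ n ∈ Ioc u x, (n : ℝ) ^ (β - 1) : ℝ) : ℂ) =
          (charPrimeSum χe x (x - u) + (charZeroSumTrunc χe x T - charZeroSumTrunc χe u T)) -
          (∑ ρ ∈ S', ((DirichletDisc.zeroOrder χe ρ : ℝ) : ℂ) *
            ((((x : ℝ) : ℂ) ^ ρ - ((u : ℝ) : ℂ) ^ ρ) / ρ)) +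
          (((∑ n ∈ Ioc u x, (n : ℝ) ^ (β - 1) : ℝ) : ℂ) -
            ((((x : ℝ) : ℂ) ^ ρ₀ - ((u : ℝ) : ℂ) ^ ρ₀) / ρ₀)) := by
        rw [hZsplit]; ring
      rw [h1]
      refine (norm_add_le _ _).trans ?_
      have h2 := norm_sub_le
        (charPrimeSum χe x (x - u) + (charZeroSumTrunc χe x T - charZeroSumTrunc χe u T))
        (∑ ρ ∈ S', ((DirichletDisc.zeroOrder χe ρ : ℝ) : ℂ) *
            ((((x : ℝ) : ℂ) ^ ρ - ((u : ℝ) : ℂ) ^ ρ) / ρ))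
      linarith [hblock, hE_le, hZ', hcorr]
    have ht : ((x : ℝ) - u) ≤ h := by
      have h1 : (u : ℝ) ≥ y := by exact_mod_cast hyu
      have h2 : ((y : ℕ) : ℝ) ≥ (x : ℝ) - h := by
        rw [hy]
        rcases le_total h x with hh | hh
        · rw [Nat.cast_sub hh]
        · rw [Nat.sub_eq_zero_of_le hh]; push_cast; linarith [(Nat.cast_le.mpr hh : (x:ℝ) ≤ h)]
      linarith
    calc ((h : ℝ) + N / P)⁻¹ * ‖gallagherTermExc χe β χe x h‖
        ≤ ((h : ℝ) + N / P)⁻¹ * (((Real.log 4 + 2) * u₀ + E + 1) + ((x : ℝ) - u) * U) := by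
          apply mul_le_mul_of_nonneg_left _ hw0
          rw [hsplit]
          refine (norm_add_le _ _).trans ?_
          linarith [hleft, hright]
      _ ≤ ((N : ℝ) / P)⁻¹ * ((Real.log 4 + 2) * u₀ + E + 1) + U :=
          weight_mul_le (Nat.cast_nonneg h) hNP (by positivity) ht hU0
      _ = U + P / N * ((Real.log 4 + 2) * u₀ + E + 1) := by rw [inv_div]; ring

end Literature.NumberTheory.Sieve.MontgomeryVaughan1975
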